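/-
Origin: expansion seat `planner-pub-hodgecm-pv06-g3-0`, handover #7 v4 2026-08-18T07:04:02Z (`HOME/pub-hodgecm-pv06-g3/lean/Pv06g3/ModelAnnihilation.lean`, md5 c24cbed0, 140 lines);
landed by the gen-7 packager in gate run 25 as `HodgeCM/Automorphic/ModelAnnihilation.lean` (import ^import Prl1g3\.→import HodgeCM.Automorphic. ×1; import ^import Pv[0-9]+g[0-9]+\.→import HodgeCM.PerL34. ×1).
-/
/-
Origin: HOME/pub-hodgecm-pv06-g3/lean/Pv06g3/ModelAnnihilation.lean — session planner-pub-hodgecm-pv06-g3-0 (unit pub-hodgecm-pv06-g3,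
DAG-NODE PROVER #06 of 15, generation 3).  Intended final place: `HodgeCM/Automorphic/ModelAnnihilation.lean`.  WIP imports:
`Prl1g3.ModelCarrier` (byte mirror of prl1-g3's run-25 file 529480c970b9) ↦ `HodgeCM.Automorphic.ModelCarrier`;
`Pv06g3.AnnihilationModel` ↦ `HodgeCM.PerL34.AnnihilationModel` (my handover #8; it imports `AnnihilationRep`, #5).
Closed: nothing cited, nothing posited.

# The headline hypothesis `TorusAnalytic` of the model carrier, with AX8 DISCHARGED

prl1-g3's `ModelCarrier.lean` builds the representation-theoretic theta carrier from MODELS and proves the three core axioms,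
leaving as the sole analytic hypothesis of the headline theorems (`Assembly.COR_CM_endState_ofModels` …)

  `Md.TorusAnalytic`  =  for every context, the SIX-field records `(Md.t12 V c).Analytic`, `(Md.t34 V c).Analytic`.

One of the six, `AX8_annihilation` (Prop 3.6 Step 2), is a THEOREM given a labelled `RepAnnihilationDatum`
(`AnnihilationRep.lean`: `analytic_of_analytic5`).  Hence:

  `torusAnalytic_of_data : (∀ V c, (Md.t12 V c).Analytic5) → (∀ V c, RepAnnihilationDatum _ (Md.t12 V c)) →`
  `                        (∀ V c, (Md.t34 V c).Analytic5) → (∀ V c, RepAnnihilationDatum _ (Md.t34 V c)) → Md.TorusAnalytic`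

(unitarity AX9 from `ModelThetaData.core_analytic`, a theorem of the model), and — since the `U(W)` side of every context IS a
cocompact `QuotientModel` with `R = ρHom ν` by `rfl` — the sharper `torusAnalytic_of_quotientData`, whose datum per context is the
REDUCED `QuotientTorusDatum` of `AnnihilationModel.lean` (the twelve core-side fields and, for first-countable `G`, the four
`[SETUP D7]` smoothing fields constructed; §0 registers the three measure / separation instances of a `QuotientModel` this needs
and its `smoothingData`).  prl1-g3's headline theorems are not restated.
-/
import Summits.HodgeConjecture.HodgeCM.Automorphic.ModelCarrier
import Summits.HodgeConjecture.HodgeCM.PerL34.AnnihilationModel_2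

set_option autoImplicit false

noncomputable section

namespace HodgeCM

open MeasureTheory HodgeCM.PerL34.QuotientSmoothing

/-! ## §0  Instances of a `QuotientModel`: `ν` is finite and inner regular, `G ⧸ Γ` is Hausdorff -/
namespace QuotientModel

variable (Q : QuotientModel)

/-- (Ported verbatim from the HodgeCMPerL package; no docstring in the source.) -/
instance isFiniteMeasure_ν : IsFiniteMeasure Q.ν :=
  isFiniteMeasure_map_restrict (Γ := Q.Γ) Q.μ (measure_fundamentalDomain_lt_top Q.μ Q.isFundamentalDomain).ne

/-- (Ported verbatim from the HodgeCMPerL package; no docstring in the source.) -/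
instance innerRegularCompactLTTop_ν : Q.ν.InnerRegularCompactLTTop :=
  innerRegularCompactLTTop_map_restrict (Γ := Q.Γ) Q.μ Q.𝓕

/-- (Ported verbatim from the HodgeCMPerL package; no docstring in the source.) -/
instance t2Space_quotient : T2Space (Q.G ⧸ Q.Γ) :=
  haveI := Q.isClosed_Γ
  inferInstance

/-- **The `[SETUP D7]` smoothing data of a `QuotientModel` with first-countable `G`** (`AnnihilationModel.smoothingData_haar`). -/
def smoothingData [FirstCountableTopology Q.G] : PerL34.Annihilation.SmoothingData Q.ν Q.R :=
  PerL34.Annihilation.smoothingData_haar Q.isClosed_Γ Q.μ Q.isFundamentalDomain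

end QuotientModel

namespace Universe
namespace ModelThetaData

open HodgeCM.PerL34.Annihilation

variable {U : Universe} (Md : U.ModelThetaData)

/-- **`TorusAnalytic` from the 2 × 5 AX5b/AX12 fields and 2 labelled annihilation datums per context** — AX8 (×2) is no
longer a hypothesis of the model carrier's headline theorems. -/
theorem torusAnalytic_of_data
    (h12 : ∀ {L : CMField} {ι₁ : L →+* ℂ} (V : HermSpace3 L ι₁) (c : SeesawCtx L), (Md.t12 V c).Analytic5)
    (A12 : ∀ {L : CMField} {ι₁ : L →+* ℂ} (V : HermSpace3 L ι₁) (c : SeesawCtx L),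
      RepAnnihilationDatum (Md.coreData V c).toCore (Md.t12 V c))
    (h34 : ∀ {L : CMField} {ι₁ : L →+* ℂ} (V : HermSpace3 L ι₁) (c : SeesawCtx L), (Md.t34 V c).Analytic5)
    (A34 : ∀ {L : CMField} {ι₁ : L →+* ℂ} (V : HermSpace3 L ι₁) (c : SeesawCtx L),
      RepAnnihilationDatum (Md.coreData V c).toCore (Md.t34 V c)) :
    Md.TorusAnalytic where
  t12 := fun V c => analytic_of_analytic5 (h12 V c) (A12 V c) (Md.coreData V c).toCore_analytic
  t34 := fun V c => analytic_of_analytic5 (h34 V c) (A34 V c) (Md.coreData V c).toCore_analytic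

/-- … hence the full analytic record of the model carrier from those data. -/
theorem toRep_analytic_of_data
    (h12 : ∀ {L : CMField} {ι₁ : L →+* ℂ} (V : HermSpace3 L ι₁) (c : SeesawCtx L), (Md.t12 V c).Analytic5)
    (A12 : ∀ {L : CMField} {ι₁ : L →+* ℂ} (V : HermSpace3 L ι₁) (c : SeesawCtx L),
      RepAnnihilationDatum (Md.coreData V c).toCore (Md.t12 V c))
    (h34 : ∀ {L : CMField} {ι₁ : L →+* ℂ} (V : HermSpace3 L ι₁) (c : SeesawCtx L), (Md.t34 V c).Analytic5)
    (A34 : ∀ {L : CMField} {ι₁ : L →+* ℂ} (V : HermSpace3 L ι₁) (c : SeesawCtx L),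
      RepAnnihilationDatum (Md.coreData V c).toCore (Md.t34 V c)) :
    Md.toRep.Analytic :=
  Md.toRep_analytic (Md.torusAnalytic_of_data h12 A12 h34 A34)

/-- **`TorusAnalytic` from the REDUCED model data**: per context, first countability of `U(W)(𝔸)` (the model group),
the 2 × 5 AX5b/AX12 fields and two `QuotientTorusDatum`s (torus, characters and toric periods of `[T]`, the finite-adelic
factor, and the labelled inputs `unfold` [AX12(ii)], `fourier`/`dense` [PRINT]) — the `U(W)` side's `C([U(W)])`, `j`, `R` on it,
the evaluations, AND the `[SETUP D7]` smoothing operators being CONSTRUCTED over the cocompact model (`AnnihilationModel.lean`),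
and `R = ρHom ν` holding by `rfl`. -/
theorem torusAnalytic_of_quotientData
    (hfc : ∀ {L : CMField} {ι₁ : L →+* ℂ} (V : HermSpace3 L ι₁) (c : SeesawCtx L), FirstCountableTopology (Md.quot V c).G)
    (h12 : ∀ {L : CMField} {ι₁ : L →+* ℂ} (V : HermSpace3 L ι₁) (c : SeesawCtx L), (Md.t12 V c).Analytic5)
    (A12 : ∀ {L : CMField} {ι₁ : L →+* ℂ} (V : HermSpace3 L ι₁) (c : SeesawCtx L),
      QuotientTorusDatum (Md.quot V c).ν (Md.coreData V c).toCore (Md.t12 V c))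
    (h34 : ∀ {L : CMField} {ι₁ : L →+* ℂ} (V : HermSpace3 L ι₁) (c : SeesawCtx L), (Md.t34 V c).Analytic5)
    (A34 : ∀ {L : CMField} {ι₁ : L →+* ℂ} (V : HermSpace3 L ι₁) (c : SeesawCtx L),
      QuotientTorusDatum (Md.quot V c).ν (Md.coreData V c).toCore (Md.t34 V c)) :
    Md.TorusAnalytic where
  t12 := fun V c =>
    haveI := hfc V c
    analytic_of_quotientTorusDatum (h12 V c) (A12 V c) (Md.quot V c).smoothingData rfl (Md.coreData V c).toCore_analytic
  t34 := fun V c =>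
    haveI := hfc V c
    analytic_of_quotientTorusDatum (h34 V c) (A34 V c) (Md.quot V c).smoothingData rfl (Md.coreData V c).toCore_analytic

/-- … hence the full analytic record of the model carrier from the reduced data. -/
theorem toRep_analytic_of_quotientData
    (hfc : ∀ {L : CMField} {ι₁ : L →+* ℂ} (V : HermSpace3 L ι₁) (c : SeesawCtx L), FirstCountableTopology (Md.quot V c).G)
    (h12 : ∀ {L : CMField} {ι₁ : L →+* ℂ} (V : HermSpace3 L ι₁) (c : SeesawCtx L), (Md.t12 V c).Analytic5)
    (A12 : ∀ {L : CMField} {ι₁ : L →+* ℂ} (V : HermSpace3 L ι₁) (c : SeesawCtx L),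
      QuotientTorusDatum (Md.quot V c).ν (Md.coreData V c).toCore (Md.t12 V c))
    (h34 : ∀ {L : CMField} {ι₁ : L →+* ℂ} (V : HermSpace3 L ι₁) (c : SeesawCtx L), (Md.t34 V c).Analytic5)
    (A34 : ∀ {L : CMField} {ι₁ : L →+* ℂ} (V : HermSpace3 L ι₁) (c : SeesawCtx L),
      QuotientTorusDatum (Md.quot V c).ν (Md.coreData V c).toCore (Md.t34 V c)) :
    Md.toRep.Analytic :=
  Md.toRep_analytic (Md.torusAnalytic_of_quotientData hfc h12 A12 h34 A34)

/-- **`TorusAnalytic` from COMPACT-MODEL data** (`CompactTorusDatum`: additionally `PT := ∫_{[T]} · conj ξ`, with `PT_cov` and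
`fourier` PROVED from the [PRINT] point-separation input `hsep`). -/
theorem torusAnalytic_of_compactData
    (hfc : ∀ {L : CMField} {ι₁ : L →+* ℂ} (V : HermSpace3 L ι₁) (c : SeesawCtx L), FirstCountableTopology (Md.quot V c).G)
    (h12 : ∀ {L : CMField} {ι₁ : L →+* ℂ} (V : HermSpace3 L ι₁) (c : SeesawCtx L), (Md.t12 V c).Analytic5)
    (B12 : ∀ {L : CMField} {ι₁ : L →+* ℂ} (V : HermSpace3 L ι₁) (c : SeesawCtx L),
      CompactTorusDatum (Md.quot V c).ν (Md.coreData V c).toCore (Md.t12 V c))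
    (h34 : ∀ {L : CMField} {ι₁ : L →+* ℂ} (V : HermSpace3 L ι₁) (c : SeesawCtx L), (Md.t34 V c).Analytic5)
    (B34 : ∀ {L : CMField} {ι₁ : L →+* ℂ} (V : HermSpace3 L ι₁) (c : SeesawCtx L),
      CompactTorusDatum (Md.quot V c).ν (Md.coreData V c).toCore (Md.t34 V c)) :
    Md.TorusAnalytic :=
  Md.torusAnalytic_of_quotientData hfc h12 (fun V c => (B12 V c).toQuotient) h34 (fun V c => (B34 V c).toQuotient)

end ModelThetaData
end Universe
end HodgeCM

end
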